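import Summits.PneNP.PneNP.Theorems.ExpanderLinearGeneratorsResolutionNFreeCore
import Summits.PneNP.PneNP.Theorems.ExpanderLinearGeneratorsResolutionNFreeCount
import HarnessLib

/-!
# The n-free resolution-size rung for expanding linear systems, III: the master inequality

Support file for crux `stmt-PneNP-11442` (`ExpansionForcesDepthFregeSize`, the expansion-scale
law). Files I (deterministic core) and II (counting) are combined into the MASTER INEQUALITY of the
load-bounded restriction method (`one_le_length_mul`): if the row supports of
`E : Fin m → LinEqMod 2 n` have size `≤ ℓ` and form an `(r, c)`-boundary expander (`r ≥ 2`), then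
for every resolution refutation `π` of `sumEncoding 1 E`, every `L < c`, every
`W < (c - L) r / 2` and every `K`,

  `1 ≤ |π| · ( 2^ℓ / (K+1)^{L+1} + ((2K+1)/(2K+2))^{W/2+1} )`.

Neither `n` nor `m` occurs: the overload term is charged to the rows whose clauses `π` downloads,
of which there are at most `|π|`. File IV turns this into the law `|π| ≥ r^{(1-ε)⌈3ℓ/4⌉}/2^{ℓ+1}`.

Proof: every sample `(u, y)` of the space of file II is BAD — some downloaded row is overloaded,
or some line of `π` stays unsatisfied with `> W` unassigned literals — for otherwise file I's
`exists_unsatisfied_wide_line` is contradicted; and bad samples are few by file II.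

References: P. Beame, T. Pitassi, FOCS 1996; E. Ben-Sasson, A. Wigderson, J. ACM 48 (2001), §3,
Thm. 6.5; J. Krajíček, *Proof complexity* (CUP 2019), §13.4.
-/

namespace Summit.PneNP.PneNP.Theorems.ResNFree

set_option linter.dupNamespace false -- `Summit.PneNP.PneNP.…`: summit = sub-problem (D-0017)

open Finset Literature.Computability.Complexity Literature.Computability.MetaComplexity
open Summit.PneNP.PneNP.Theorems.ResKRestriction

variable {m n : ℕ}

/-- A system with a resolution refutation of its XOR-CNF has a row. [folklore] -/
theorem pos_of_isResRefutation (E : Fin m → LinEqMod 2 n) {π : List (ResLine ℕ)}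
    (hπ : IsResRefutation (sumEncoding 1 E) π) : 0 < m := by
  rcases Nat.eq_zero_or_pos m with h0 | h
  swap
  · exact h
  exfalso
  subst h0
  obtain ⟨hder, l, hl, -⟩ := hπ
  have hlen : 0 < π.length := List.length_pos_of_mem hl
  have hv := hder 0 hlen
  rcases h0r : (π[0]'hlen).rule with _ | ⟨i, j, v⟩ | ⟨i⟩
  · simp only [IsValidResLine, h0r] at hv
    simp [CNF.clauseFinsets, sumEncoding] at hv
  · simp only [IsValidResLine, h0r] at hv
    obtain ⟨hi, -⟩ := hv
    simp at hi
  · simp only [IsValidResLine, h0r] at hv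
    obtain ⟨hi, -⟩ := hv
    simp at hi

/-- Every initial line of a refutation of `sumEncoding 1 E` downloads a clause of the canonical
CNF of some row. [folklore] -/
theorem exists_row_of_initial (E : Fin m → LinEqMod 2 n) {π : List (ResLine ℕ)}
    (hπ : IsResRefutation (sumEncoding 1 E) π) {l : ResLine ℕ} (hl : l ∈ π)
    (hrule : l.rule = ResRule.initial) :
    ∃ k : Fin m, ∃ cl ∈ equationCNF 1 (E k), cl.toFinset = l.clause := by
  obtain ⟨i, hi, rfl⟩ := List.getElem_of_mem hl
  have hv := hπ.1 i hi
  simp only [IsValidResLine, hrule] at hv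
  simp only [CNF.clauseFinsets, List.mem_map] at hv
  obtain ⟨cl, hcl, hclC⟩ := hv
  simp only [sumEncoding, List.mem_flatMap, List.mem_finRange, true_and] at hcl
  obtain ⟨k, hk⟩ := hcl
  exact ⟨k, cl, hk, hclC⟩

/-- The assigned variables of a row: `rowVars E k ∩ A(u)` is the image of the support points with
`u j = 0`. [folklore] -/
theorem card_rowVars_inter_le (E : Fin m → LinEqMod 2 n) (k : Fin m) {K : ℕ}
    (u : Fin n → Fin (K + 1)) :
    ((rowVars E k) ∩ ((univ.filter fun j : Fin n => u j = 0).map Fin.valEmbedding)).card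
      ≤ ((E k).supp.filter fun j => u j = 0).card := by
  classical
  rw [← Finset.card_map Fin.valEmbedding]
  refine Finset.card_le_card fun v hv => ?_
  rw [Finset.mem_inter] at hv
  obtain ⟨hv1, hv2⟩ := hv
  obtain ⟨j, hj, rfl⟩ := mem_rowVars.1 hv1
  obtain ⟨j', hj', hjj'⟩ := Finset.mem_map.1 hv2
  have : j' = j := Fin.ext (by simpa using hjj')
  subst this
  exact Finset.mem_map.2 ⟨j', Finset.mem_filter.2 ⟨hj, (Finset.mem_filter.1 hj').2⟩, rfl⟩

/-- **The master inequality of the load-bounded restriction method (n-free, m-free).** Let the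
row supports of `E` have size `≤ ℓ` and form an `(r, c)`-boundary expander, `r ≥ 2`. For every
resolution refutation `π` of `sumEncoding 1 E`, every `L < c`, `W < (c - L) r / 2` and `K`,
`1 ≤ |π| · (2^ℓ / (K+1)^{L+1} + ((2K+1)/(2K+2))^{W/2+1})`.
[Beame–Pitassi 1996; Ben-Sasson–Wigderson 2001, §3, Thm. 6.5] [folklore] -/
theorem one_le_length_mul (E : Fin m → LinEqMod 2 n) {r c : ℝ}
    (hexp : IsBoundaryExpander (rowVars E) r c) (hr : 2 ≤ r) {ℓ L W : ℕ} (K : ℕ)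
    (hsparse : ∀ i, (E i).supp.card ≤ ℓ) (hcL : (L : ℝ) < c)
    (hW : (W : ℝ) < (c - L) * r / 2) {π : List (ResLine ℕ)}
    (hπ : IsResRefutation (sumEncoding 1 E) π) :
    (1 : ℝ) ≤ π.length *
      ((2 : ℝ) ^ ℓ / ((K : ℝ) + 1) ^ (L + 1) + ((2 * (K : ℝ) + 1) / (2 * K + 2)) ^ (W / 2 + 1)) := by
  classical
  have hm : 0 < m := pos_of_isResRefutation E hπ
  haveI : Nonempty (Fin m) := ⟨⟨0, hm⟩⟩
  -- the rows of the initial lines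
  have hinit : ∀ l ∈ π, l.rule = ResRule.initial →
      ∃ k : Fin m, ∃ cl ∈ equationCNF 1 (E k), cl.toFinset = l.clause :=
    fun l hl hrule => exists_row_of_initial E hπ hl hrule
  choose! row cl hcl hclC using hinit
  set U : Finset (Fin m) := ((π.filter fun l => l.rule = ResRule.initial).map row).toFinset
    with hUdef
  have hUcard : U.card ≤ π.length :=
    (List.toFinset_card_le _).trans (by rw [List.length_map]; exact List.length_filter_le _ _)
  have hU : ∀ l ∈ π, l.rule = ResRule.initial →
      ∃ k ∈ U, ∃ cl ∈ equationCNF 1 (E k), cl.toFinset = l.clause := by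
    intro l hl hrule
    refine ⟨row l, ?_, cl l, hcl l hl hrule, hclC l hl hrule⟩
    simp only [hUdef, List.mem_toFinset, List.mem_map, List.mem_filter, decide_eq_true_eq]
    exact ⟨l, ⟨hl, hrule⟩, rfl⟩
  -- the sample space, its restrictions and assigned sets
  set ρ : (Fin n → Fin (K + 1)) × (Fin n → Bool) → ℕ → Option Bool := fun ω v =>
    if h : v < n then (if ω.1 ⟨v, h⟩ = 0 then some (ω.2 ⟨v, h⟩) else none) else some false
    with hρ
  set Aset : (Fin n → Fin (K + 1)) × (Fin n → Bool) → Finset ℕ := fun ω =>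
    (univ.filter fun j : Fin n => ω.1 j = 0).map Fin.valEmbedding with hAset
  -- every sample is bad
  have hbad : ∀ ω : (Fin n → Fin (K + 1)) × (Fin n → Bool),
      (∃ k ∈ U, L + 1 ≤ ((rowVars E k) ∩ Aset ω).card) ∨
      (∃ l ∈ π, ¬ SatisfiedBy (ρ ω) l.clause ∧ W < (restrictClause (ρ ω) l.clause).card) := by
    intro ω
    by_contra h
    push Not at h
    obtain ⟨h1, h2⟩ := h
    have hload : ∀ k ∈ U, ((rowVars E k) ∩ Aset ω).card ≤ L :=
      fun k hk => Nat.lt_succ_iff.1 (h1 k hk)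
    have hρA : ∀ v, v < n → v ∉ Aset ω → ρ ω v = none := by
      intro v hv hvA
      simp only [hρ, hv, ↓reduceDIte]
      split_ifs with h0
      · refine absurd ?_ hvA
        simp only [hAset]
        exact Finset.mem_map.2 ⟨⟨v, hv⟩, Finset.mem_filter.2 ⟨Finset.mem_univ _, h0⟩, rfl⟩
      · rfl
    obtain ⟨l, hl, hns, hwide⟩ :=
      exists_unsatisfied_wide_line E hexp hr hcL hW hπ hU hload (ρ ω) hρA
    exact absurd hwide (not_lt.2 (h2 l hl hns))
  -- the bad sets
  set B₁ : Fin m → Finset ((Fin n → Fin (K + 1)) × (Fin n → Bool)) := fun k =>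
    univ.filter fun ω => L + 1 ≤ ((rowVars E k) ∩ Aset ω).card with hB₁
  set B₂ : ResLine ℕ → Finset ((Fin n → Fin (K + 1)) × (Fin n → Bool)) := fun l =>
    univ.filter fun ω => ¬ SatisfiedBy (ρ ω) l.clause ∧ W < (restrictClause (ρ ω) l.clause).card
    with hB₂
  have hcover : (univ : Finset ((Fin n → Fin (K + 1)) × (Fin n → Bool)))
      ⊆ U.biUnion B₁ ∪ π.toFinset.biUnion B₂ := by
    intro ω _
    rcases hbad ω with ⟨k, hk, hkω⟩ | ⟨l, hl, hlω⟩
    · refine Finset.mem_union_left _ (Finset.mem_biUnion.2 ⟨k, hk, ?_⟩)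
      simp only [hB₁, Finset.mem_filter, Finset.mem_univ, true_and]
      exact hkω
    · refine Finset.mem_union_right _ (Finset.mem_biUnion.2 ⟨l, List.mem_toFinset.2 hl, ?_⟩)
      simp only [hB₂, Finset.mem_filter, Finset.mem_univ, true_and]
      exact hlω
  -- sizes
  set N : ℕ := (K + 1) ^ n * 2 ^ n with hN
  have hcardΩ : Fintype.card ((Fin n → Fin (K + 1)) × (Fin n → Bool)) = N := card_sample n K
  have hNpos : (0 : ℝ) < N := by rw [hN]; positivity
  have hKpos : (0 : ℝ) < ((K : ℝ) + 1) ^ (L + 1) := by positivity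
  have hB₁card : ∀ k, ((B₁ k).card : ℝ) ≤ (2 : ℝ) ^ ℓ / ((K : ℝ) + 1) ^ (L + 1) * N := by
    intro k
    have h := card_overload_le (K := K) (L := L) ((E k).supp) (hsparse k) (B₁ k) fun ω hω => by
      have hω' := (Finset.mem_filter.1 hω).2
      exact hω'.trans (card_rowVars_inter_le E k ω.1)
    rw [div_mul_eq_mul_div, le_div_iff₀ hKpos]
    exact h
  have hB₂card : ∀ l : ResLine ℕ,
      ((B₂ l).card : ℝ) ≤ ((2 * (K : ℝ) + 1) / (2 * K + 2)) ^ (W / 2 + 1) * N := by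
    intro l
    exact card_survive_le (K := K) (W := W) l.clause (B₂ l) fun ω hω => (Finset.mem_filter.1 hω).2
  have htot : (N : ℝ) ≤ U.card * ((2 : ℝ) ^ ℓ / ((K : ℝ) + 1) ^ (L + 1) * N) +
      π.toFinset.card * (((2 * (K : ℝ) + 1) / (2 * K + 2)) ^ (W / 2 + 1) * N) := by
    have h1 : N ≤ ∑ k ∈ U, (B₁ k).card + ∑ l ∈ π.toFinset, (B₂ l).card :=
      calc N = (univ : Finset ((Fin n → Fin (K + 1)) × (Fin n → Bool))).card := by
            rw [Finset.card_univ, hcardΩ]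
        _ ≤ (U.biUnion B₁ ∪ π.toFinset.biUnion B₂).card := Finset.card_le_card hcover
        _ ≤ (U.biUnion B₁).card + (π.toFinset.biUnion B₂).card := Finset.card_union_le _ _
        _ ≤ ∑ k ∈ U, (B₁ k).card + ∑ l ∈ π.toFinset, (B₂ l).card :=
            Nat.add_le_add Finset.card_biUnion_le Finset.card_biUnion_le
    have h1' : (N : ℝ) ≤ ∑ k ∈ U, ((B₁ k).card : ℝ) + ∑ l ∈ π.toFinset, ((B₂ l).card : ℝ) := by
      exact_mod_cast h1
    refine h1'.trans (add_le_add ?_ ?_)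
    · calc ∑ k ∈ U, ((B₁ k).card : ℝ)
          ≤ ∑ k ∈ U, (2 : ℝ) ^ ℓ / ((K : ℝ) + 1) ^ (L + 1) * N := Finset.sum_le_sum fun k _ => hB₁card k
        _ = U.card * ((2 : ℝ) ^ ℓ / ((K : ℝ) + 1) ^ (L + 1) * N) := by
            rw [Finset.sum_const, nsmul_eq_mul]
    · calc ∑ l ∈ π.toFinset, ((B₂ l).card : ℝ)
          ≤ ∑ l ∈ π.toFinset, ((2 * (K : ℝ) + 1) / (2 * K + 2)) ^ (W / 2 + 1) * N :=
            Finset.sum_le_sum fun l _ => hB₂card l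
        _ = π.toFinset.card * (((2 * (K : ℝ) + 1) / (2 * K + 2)) ^ (W / 2 + 1) * N) := by
            rw [Finset.sum_const, nsmul_eq_mul]
  -- divide by `N` and bound the two counts by `|π|`
  have hU' : (U.card : ℝ) ≤ π.length := by exact_mod_cast hUcard
  have hπ' : (π.toFinset.card : ℝ) ≤ π.length := by exact_mod_cast List.toFinset_card_le π
  have ht₁ : (0 : ℝ) ≤ (2 : ℝ) ^ ℓ / ((K : ℝ) + 1) ^ (L + 1) := by positivity
  have ht₂ : (0 : ℝ) ≤ ((2 * (K : ℝ) + 1) / (2 * K + 2)) ^ (W / 2 + 1) := by positivity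
  have h2 : (N : ℝ) ≤ π.length * ((2 : ℝ) ^ ℓ / ((K : ℝ) + 1) ^ (L + 1) +
      ((2 * (K : ℝ) + 1) / (2 * K + 2)) ^ (W / 2 + 1)) * N := by
    calc (N : ℝ) ≤ U.card * ((2 : ℝ) ^ ℓ / ((K : ℝ) + 1) ^ (L + 1) * N) +
          π.toFinset.card * (((2 * (K : ℝ) + 1) / (2 * K + 2)) ^ (W / 2 + 1) * N) := htot
      _ ≤ π.length * ((2 : ℝ) ^ ℓ / ((K : ℝ) + 1) ^ (L + 1) * N) +
          π.length * (((2 * (K : ℝ) + 1) / (2 * K + 2)) ^ (W / 2 + 1) * N) :=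
          add_le_add (mul_le_mul_of_nonneg_right hU' (by positivity))
            (mul_le_mul_of_nonneg_right hπ' (by positivity))
      _ = π.length * ((2 : ℝ) ^ ℓ / ((K : ℝ) + 1) ^ (L + 1) +
          ((2 * (K : ℝ) + 1) / (2 * K + 2)) ^ (W / 2 + 1)) * N := by ring
  by_contra hlt
  push Not at hlt
  have : π.length * ((2 : ℝ) ^ ℓ / ((K : ℝ) + 1) ^ (L + 1) +
      ((2 * (K : ℝ) + 1) / (2 * K + 2)) ^ (W / 2 + 1)) * N < 1 * N :=
    mul_lt_mul_of_pos_right hlt hNpos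
  linarith

end Summit.PneNP.PneNP.Theorems.ResNFree
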